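import Literature.NumberTheory.Rogawski1990.ArchStableOrbitalWallPackage       -- ★ p841698 (R1-e-pkg): the wall-data package of one carrier; brings ★ p841638, ★ p841391, ★ (R1-a), ★ (δ8), ★ (R1-f)
import Literature.NumberTheory.Rogawski1990.ArchStableOrbitalPlaceInduction    -- ★ p841576 (R1-e-core): the abstract place induction
import HarnessLib

/-!
# EQUAL REGULAR STABLE ORBITAL INTEGRALS ⇒ EQUAL WALL END STATES — the «method of §8.2» run on two inner forms at all places ((R1-e-two) of R1 «(L-use) at all indefinite
# places»; Rogawski 1990 §8.2 p. 122–124, §14.5 p. 238–239)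

Topic `NumberTheory/Rogawski1990`; namespace `Literature.NumberTheory.Rogawski1990`.  THEOREMS ONLY (no `def`, no instance, no notation, no axiom, no `sorry`).
Cell `pub/hodgecm-mathlib`, ENGINE T1 (crux H413 = `stmt-HodgeConjecture-24833`); floor-2 road «(J-nc) in-house», brick (R1-e-two) of R1 `stub_LuseAllPlaces` (LEAD F0P3a-plan (g9)
WORD T8-77; census `CENSUS-R1e-LuseAssembly` 31a194b6 (m4); author F0P3a-p07 (g7), 2026-09-01).

WHAT.  Side `α`: a diagonal carrier `U(diag α)` with all its per-place data (as in ★ p841698: `νw v`, `νH v τ`, the transported Haar measures `ντ v τ`, reference walls `z₁ v`), a canonical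
regular family `m` for the product Haar measure `νinf`, a global test function `Θ`.  Side `β`: a second diagonal carrier over the same CM field with per-place Haar measures `νw′`,
canonical family `m′` for `νinf′`, test function `Θ′`, and ABSTRACT wall data `(κ′, Wm′)` — Radon wall measures with the one-step jump law of ★ p841576's `hstep` for the scaled state
`K_β⁻¹·∫ Θ′ d(⊗ ·)` (★ p841698 `exists_wallCoef_hstep` produces such data for the β-side; it is kept abstract here so that the two carriers' measure families never meet in one
elaboration).  Wall point `z⁰` (`z⁰_v 0 = z⁰_v 2 ≠ z⁰_v 1` everywhere).  HYPOTHESIS `hreg`: the REGULAR states agree at torus points of the same angles, in orbit-measure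
currency `K_α⁻¹ Σ_ρ ∫Θ d(⊗_v reg_α(z_v∘ρ_v)) = K_β⁻¹ Σ_ρ ∫Θ′ d(⊗_v reg_β(z_v∘ρ_v))` — by ★ p841429 (R1-0) on both sides this is `Φ^st_m(t_α(z), Θ∘coe) = Φ^st_{m′}(t_β(z), Θ′∘coe)`
((14.2.1) after (T-d)); kept in orbit currency so that no canonical-family binders enter this file.  CONCLUSION **`exists_wallCoef_sum_prod_mul_eq_of_regular_eq`**: `∃ c` (J1's
constants of side `α`, `≠ 0` at noncompact walls) with `Σ_ρ (Π_v κ_v(ρ_v))·(K_α⁻¹ ∫ Θ d(⊗_v Wm_v(ρ_v))) = Σ_ρ (Π_v κ′_v(ρ_v))·(K_β⁻¹ ∫ Θ′ d(⊗_v Wm′_v(ρ_v)))`, `κ_v(ρ) = (cw ? 2 : c_v(ρ⁻¹))`,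
`Wm_v(ρ)` the explicit compact-wall ∕ singular orbit measures of side `α`.  PROOF = ★ p841576 fed with ★ p841698 (side `α`), the abstract `β` data, `hR` ★, and `hreg`.
HONEST LABEL: HC_CM is proved only modulo the 7 printed citations until rung 0 closes; this file is the assembly of ★ bricks and pays nothing by itself.

## References
* [Rogawski1990] J. D. Rogawski, *Automorphic Representations of Unitary Groups in Three Variables*, Ann. of Math. Stud. 123 (1990), §8.2 p. 122–124, §14.5 p. 238–239.
* [Varadarajan1989] V. S. Varadarajan, *An Introduction to Harmonic Analysis on Semisimple Lie Groups* (1989), §6.4 Thm 22.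
* [BorelJacquet1979] A. Borel, H. Jacquet, *Automorphic forms and automorphic representations*, PSPM 33.1 (1979), §4.1.
-/

set_option autoImplicit false

noncomputable section

open MeasureTheory Measure Filter Topology NumberField NumberField.InfinitePlace NumberField.mixedEmbedding Equiv Function Set
open Literature.MeasureTheory.Group Literature.NumberTheory.Automorphic Literature.NumberTheory.Automorphic.UnitaryGroup
open Literature.LinearAlgebra.Matrix
open scoped Matrix MatrixGroups Matrix.Norms.Operator ContDiff

namespace Literature.NumberTheory.Rogawski1990

variable (L : Type) [Field L] [NumberField L] [IsCMField L] (α β : Fin 3 → L)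
  [MeasurableSpace (GL (Fin 3) ℂ)] [BorelSpace (GL (Fin 3) ℂ)]
  [MeasurableSpace (arch (↥(maximalRealSubfield L)) L (IsCMField.complexConj L) 3 (Matrix.diagonal α))] [BorelSpace (arch (↥(maximalRealSubfield L)) L (IsCMField.complexConj L) 3 (Matrix.diagonal α))]

open scoped Classical in
/-- **(R1-e-two) EQUAL REGULAR ORBIT-MEASURE STATES ⇒ EQUAL WALL END STATES** (side `α` explicit, side `β` with abstract wall data; ★ p841576 + ★ p841698; `hreg` in orbit-measure currency — ★ p841429 (R1-0) converts `Φ^st` equalities into it).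
[cite: Rogawski1990, §8.2 p. 124; §14.5 p. 238–239] [cite: Varadarajan1989, §6.4 Thm 22] [cite: BorelJacquet1979, §4.1] -/
theorem exists_wallCoef_sum_prod_mul_eq_of_regular_eq
    (z0 : {w : InfinitePlace L // IsComplex w} → Fin 3 → Circle) (hwall : ∀ v, z0 v 0 = z0 v 2 ∧ z0 v 0 ≠ z0 v 1)
    -- side `α` (explicit, as in ★ p841698)
    (hα : ∀ i, α i ≠ 0) (hherm : ∀ i, (IsCMField.complexConj L (α i) : L) = α i)
    (νw : ∀ v : {w : InfinitePlace L // IsComplex w}, Measure (archLocal L 3 (Matrix.diagonal α) v)) (hνw : ∀ v, (νw v).IsHaarMeasure ∧ (νw v).IsMulRightInvariant)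
    (z₁ : {w : InfinitePlace L // IsComplex w} → Fin 3 → Circle) (h02 : ∀ v, z₁ v 0 = z₁ v 2) (h01 : ∀ v, z₁ v 0 ≠ z₁ v 1)
    [∀ (v : {w : InfinitePlace L // IsComplex w}) (τ : Perm (Fin 3)), MeasurableSpace (archLocal L 3 (Matrix.diagonal (α ∘ ⇑τ)) v ⧸ Subgroup.centralizer
      ({(⟨circleDiagonal 3 (z₁ v), circleDiagonal_mem_archLocal_diagonal L 3 (α ∘ ⇑τ) v (z₁ v)⟩ : archLocal L 3 (Matrix.diagonal (α ∘ ⇑τ)) v)} :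
        Set (archLocal L 3 (Matrix.diagonal (α ∘ ⇑τ)) v)))]
    [∀ (v : {w : InfinitePlace L // IsComplex w}) (τ : Perm (Fin 3)), BorelSpace (archLocal L 3 (Matrix.diagonal (α ∘ ⇑τ)) v ⧸ Subgroup.centralizer
      ({(⟨circleDiagonal 3 (z₁ v), circleDiagonal_mem_archLocal_diagonal L 3 (α ∘ ⇑τ) v (z₁ v)⟩ : archLocal L 3 (Matrix.diagonal (α ∘ ⇑τ)) v)} :
        Set (archLocal L 3 (Matrix.diagonal (α ∘ ⇑τ)) v)))]
    (νH : ∀ (v : {w : InfinitePlace L // IsComplex w}) (τ : Perm (Fin 3)), Measure (Subgroup.centralizer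
      ({(⟨circleDiagonal 3 (z₁ v), circleDiagonal_mem_archLocal_diagonal L 3 (α ∘ ⇑τ) v (z₁ v)⟩ : archLocal L 3 (Matrix.diagonal (α ∘ ⇑τ)) v)} :
        Set (archLocal L 3 (Matrix.diagonal (α ∘ ⇑τ)) v))))
    (hνH : ∀ v τ, (νH v τ).IsHaarMeasure ∧ (νH v τ).IsInvInvariant)
    (ντ : ∀ (v : {w : InfinitePlace L // IsComplex w}) (τ : Perm (Fin 3)), Measure (archLocal L 3 (Matrix.diagonal (α ∘ ⇑τ)) v))
    (hντi : ∀ v τ, (ντ v τ).IsHaarMeasure ∧ (ντ v τ).IsMulRightInvariant)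
    (hντ : ντ = fun v τ => (νw v).map (ContinuousMulEquiv.restrictSubgroup (GLn.conjEquiv (Matrix.GeneralLinearGroup.mkOfDetNeZero _ (det_monomial_one_ne_zero 3 τ)))
              (archLocal L 3 (Matrix.diagonal (α ∘ ⇑τ)) v) (archLocal L 3 (Matrix.diagonal α) v)
              (mem_archLocal_comp_perm_iff_conj_mem L 3 α v τ)).symm)
    (Θ : Matrix (Fin 3) (Fin 3) (mixedSpace L) → ℂ) (hΘ : ContDiff ℝ (⊤ : ℕ∞) Θ)
    (hΘc : HasCompactSupport fun g : arch (↥(maximalRealSubfield L)) L (IsCMField.complexConj L) 3 (Matrix.diagonal α) => Θ ((g : GL (Fin 3) (mixedSpace L)) : Matrix (Fin 3) (Fin 3) (mixedSpace L)))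
    -- side `β` (per-place Haar measures, canonical family, test function; ABSTRACT wall data with ★ p841576's `hWm′`, `hstep′`)
    (hβ : ∀ i, β i ≠ 0)
    (νw' : ∀ v : {w : InfinitePlace L // IsComplex w}, Measure (archLocal L 3 (Matrix.diagonal β) v)) (hνw' : ∀ v, (νw' v).IsHaarMeasure ∧ (νw' v).IsMulRightInvariant)
    (Θ' : Matrix (Fin 3) (Fin 3) (mixedSpace L) → ℂ)
    (κ' : {w : InfinitePlace L // IsComplex w} → Perm (Fin 3) → ℂ) (Wm' : ∀ v : {w : InfinitePlace L // IsComplex w}, Perm (Fin 3) → Measure (archLocal L 3 (Matrix.diagonal β) v))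
    (hWm' : ∀ v ρ, IsFiniteMeasureOnCompacts (Wm' v ρ) ∧ SigmaFinite (Wm' v ρ))
    (hstep' : ∀ (w : {w : InfinitePlace L // IsComplex w}) (ι : Type) [Fintype ι] (s : ι → ℂ) (μ : ι → ∀ v : {w : InfinitePlace L // IsComplex w}, Measure (archLocal L 3 (Matrix.diagonal β) v)),
        (∀ i v, IsFiniteMeasureOnCompacts (μ i v) ∧ SigmaFinite (μ i v)) →
        Tendsto (fun ψ : ℝ => deriv (fun ψ : ℝ => (2 * Real.sin ψ : ℂ) * ∑ i, s i * ∑ ρ : Perm (Fin 3),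
            (((∏ v : {w : InfinitePlace L // IsComplex w},
            (Finset.univ.filter fun i => 0 < (v.1.embedding (β i)).re).card.factorial *
              (3 - (Finset.univ.filter fun i => 0 < (v.1.embedding (β i)).re).card).factorial : ℕ) : ℂ)⁻¹ *
                ∫ o, Θ' ((((archPiEquivCM 3 L (Matrix.diagonal β)).symm o : arch (↥(maximalRealSubfield L)) L (IsCMField.complexConj L) 3 (Matrix.diagonal β)) : GL (Fin 3) (mixedSpace L)) : Matrix (Fin 3) (Fin 3) (mixedSpace L)) ∂(Measure.pi (Function.update (μ i) w ((νw' w).map fun y : archLocal L 3 (Matrix.diagonal β) w => y * (⟨circleDiagonal 3 ((fun j => z0 w j * Circle.exp (![(1 : ℝ), 0, -1] j * ψ)) ∘ ⇑ρ), circleDiagonal_mem_archLocal_diagonal L 3 β w ((fun j => z0 w j * Circle.exp (![(1 : ℝ), 0, -1] j * ψ)) ∘ ⇑ρ)⟩ : archLocal L 3 (Matrix.diagonal β) w) * y⁻¹))))) ψ)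
          (𝓝[>] 0)
          (𝓝 (∑ i, s i * ∑ ρ : Perm (Fin 3), κ' w ρ * (((∏ v : {w : InfinitePlace L // IsComplex w},
            (Finset.univ.filter fun i => 0 < (v.1.embedding (β i)).re).card.factorial *
              (3 - (Finset.univ.filter fun i => 0 < (v.1.embedding (β i)).re).card).factorial : ℕ) : ℂ)⁻¹ *
                ∫ o, Θ' ((((archPiEquivCM 3 L (Matrix.diagonal β)).symm o : arch (↥(maximalRealSubfield L)) L (IsCMField.complexConj L) 3 (Matrix.diagonal β)) : GL (Fin 3) (mixedSpace L)) : Matrix (Fin 3) (Fin 3) (mixedSpace L)) ∂(Measure.pi (Function.update (μ i) w (Wm' w ρ)))))))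
    -- the regular identity in orbit-measure currency (★ p841429 (R1-0) turns `Φ^st_m(t_α(z), Θ∘coe) = Φ^st_{m′}(t_β(z), Θ′∘coe)` into it)
    (hreg : ∀ z : {w : InfinitePlace L // IsComplex w} → Fin 3 → Circle, (∀ v, Function.Injective (z v)) →
      ∑ ρ : {w : InfinitePlace L // IsComplex w} → Perm (Fin 3), ((∏ v : {w : InfinitePlace L // IsComplex w},
            (Finset.univ.filter fun i => 0 < (v.1.embedding (α i)).re).card.factorial *
              (3 - (Finset.univ.filter fun i => 0 < (v.1.embedding (α i)).re).card).factorial : ℕ) : ℂ)⁻¹ *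
          ∫ o, Θ ((((archPiEquivCM 3 L (Matrix.diagonal α)).symm o : arch (↥(maximalRealSubfield L)) L (IsCMField.complexConj L) 3 (Matrix.diagonal α)) : GL (Fin 3) (mixedSpace L)) : Matrix (Fin 3) (Fin 3) (mixedSpace L))
            ∂(Measure.pi fun v : {w : InfinitePlace L // IsComplex w} => (νw v).map fun y : archLocal L 3 (Matrix.diagonal α) v =>
              y * (⟨circleDiagonal 3 (z v ∘ ⇑(ρ v)), circleDiagonal_mem_archLocal_diagonal L 3 α v (z v ∘ ⇑(ρ v))⟩ : archLocal L 3 (Matrix.diagonal α) v) * y⁻¹) =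
      ∑ ρ : {w : InfinitePlace L // IsComplex w} → Perm (Fin 3), ((∏ v : {w : InfinitePlace L // IsComplex w},
            (Finset.univ.filter fun i => 0 < (v.1.embedding (β i)).re).card.factorial *
              (3 - (Finset.univ.filter fun i => 0 < (v.1.embedding (β i)).re).card).factorial : ℕ) : ℂ)⁻¹ *
          ∫ o, Θ' ((((archPiEquivCM 3 L (Matrix.diagonal β)).symm o : arch (↥(maximalRealSubfield L)) L (IsCMField.complexConj L) 3 (Matrix.diagonal β)) : GL (Fin 3) (mixedSpace L)) : Matrix (Fin 3) (Fin 3) (mixedSpace L))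
            ∂(Measure.pi fun v : {w : InfinitePlace L // IsComplex w} => (νw' v).map fun y : archLocal L 3 (Matrix.diagonal β) v =>
              y * (⟨circleDiagonal 3 (z v ∘ ⇑(ρ v)), circleDiagonal_mem_archLocal_diagonal L 3 β v (z v ∘ ⇑(ρ v))⟩ : archLocal L 3 (Matrix.diagonal β) v) * y⁻¹)) :
    haveI : ∀ (v : {w : InfinitePlace L // IsComplex w}) (τ : Perm (Fin 3)), LocallyCompactSpace (archLocal L 3 (Matrix.diagonal (α ∘ ⇑τ)) v) := fun v τ => locallyCompactSpace_archLocal L 3 (Matrix.diagonal (α ∘ ⇑τ)) v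
    haveI : ∀ (v : {w : InfinitePlace L // IsComplex w}) (τ : Perm (Fin 3)), SecondCountableTopology (archLocal L 3 (Matrix.diagonal (α ∘ ⇑τ)) v) := fun v τ => secondCountableTopology_archLocal L 3 (Matrix.diagonal (α ∘ ⇑τ)) v
    haveI : ∀ (v : {w : InfinitePlace L // IsComplex w}) (τ : Perm (Fin 3)), (νH v τ).IsHaarMeasure := fun v τ => (hνH v τ).1
    haveI : ∀ (v : {w : InfinitePlace L // IsComplex w}) (τ : Perm (Fin 3)), (νH v τ).IsInvInvariant := fun v τ => (hνH v τ).2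
    haveI : ∀ (v : {w : InfinitePlace L // IsComplex w}) (τ : Perm (Fin 3)), (ντ v τ).IsHaarMeasure := fun v τ => (hντi v τ).1
    haveI : ∀ (v : {w : InfinitePlace L // IsComplex w}) (τ : Perm (Fin 3)), (ντ v τ).IsMulRightInvariant := fun v τ => (hντi v τ).2
    ∃ c : {w : InfinitePlace L // IsComplex w} → Perm (Fin 3) → ℂ,
      (∀ v τ, (v.1.embedding (α (τ 0))).re * (v.1.embedding (α (τ 2))).re < 0 → c v τ ≠ 0) ∧
      ∑ ρ : {w : InfinitePlace L // IsComplex w} → Perm (Fin 3), (∏ v, (if 0 < (v.1.embedding (α ((ρ v)⁻¹ 0))).re * (v.1.embedding (α ((ρ v)⁻¹ 2))).re then (2 : ℂ) else c v (ρ v)⁻¹)) *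
          (((∏ v : {w : InfinitePlace L // IsComplex w},
            (Finset.univ.filter fun i => 0 < (v.1.embedding (α i)).re).card.factorial *
              (3 - (Finset.univ.filter fun i => 0 < (v.1.embedding (α i)).re).card).factorial : ℕ) : ℂ)⁻¹ *
                ∫ o, Θ ((((archPiEquivCM 3 L (Matrix.diagonal α)).symm o : arch (↥(maximalRealSubfield L)) L (IsCMField.complexConj L) 3 (Matrix.diagonal α)) : GL (Fin 3) (mixedSpace L)) : Matrix (Fin 3) (Fin 3) (mixedSpace L)) ∂(Measure.pi (fun v : {w : InfinitePlace L // IsComplex w} =>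
              (if 0 < (v.1.embedding (α ((ρ v)⁻¹ 0))).re * (v.1.embedding (α ((ρ v)⁻¹ 2))).re then (νw v).map fun y : archLocal L 3 (Matrix.diagonal α) v => y * (⟨circleDiagonal 3 (z0 v ∘ ⇑(ρ v)), circleDiagonal_mem_archLocal_diagonal L 3 α v (z0 v ∘ ⇑(ρ v))⟩ : archLocal L 3 (Matrix.diagonal α) v) * y⁻¹
              else ((quotientMeasure _ (νH v (ρ v)⁻¹) (isClosed_coe_centralizer_singleton _) (ντ v (ρ v)⁻¹)).map
                (descConj (⟨circleDiagonal 3 (z0 v), circleDiagonal_mem_archLocal_diagonal L 3 (α ∘ ⇑(ρ v)⁻¹) v (z0 v)⟩ : archLocal L 3 (Matrix.diagonal (α ∘ ⇑(ρ v)⁻¹)) v)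
                  (Subgroup.centralizer ({(⟨circleDiagonal 3 (z₁ v), circleDiagonal_mem_archLocal_diagonal L 3 (α ∘ ⇑(ρ v)⁻¹) v (z₁ v)⟩ :
                    archLocal L 3 (Matrix.diagonal (α ∘ ⇑(ρ v)⁻¹)) v)} : Set (archLocal L 3 (Matrix.diagonal (α ∘ ⇑(ρ v)⁻¹)) v)))
                  (forall_mem_centralizer_circleDiagonal_comm_of_wall L (α ∘ ⇑(ρ v)⁻¹) v (h02 v) (h01 v) (hwall v).1 (hwall v).2) id)).map
                (ContinuousMulEquiv.restrictSubgroup (GLn.conjEquiv (Matrix.GeneralLinearGroup.mkOfDetNeZero _ (det_monomial_one_ne_zero 3 (ρ v)⁻¹)))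
              (archLocal L 3 (Matrix.diagonal (α ∘ ⇑(ρ v)⁻¹)) v) (archLocal L 3 (Matrix.diagonal α) v)
              (mem_archLocal_comp_perm_iff_conj_mem L 3 α v (ρ v)⁻¹)))))) =
      ∑ ρ : {w : InfinitePlace L // IsComplex w} → Perm (Fin 3), (∏ v, κ' v (ρ v)) *
          (((∏ v : {w : InfinitePlace L // IsComplex w},
            (Finset.univ.filter fun i => 0 < (v.1.embedding (β i)).re).card.factorial *
              (3 - (Finset.univ.filter fun i => 0 < (v.1.embedding (β i)).re).card).factorial : ℕ) : ℂ)⁻¹ *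
                ∫ o, Θ' ((((archPiEquivCM 3 L (Matrix.diagonal β)).symm o : arch (↥(maximalRealSubfield L)) L (IsCMField.complexConj L) 3 (Matrix.diagonal β)) : GL (Fin 3) (mixedSpace L)) : Matrix (Fin 3) (Fin 3) (mixedSpace L)) ∂(Measure.pi (fun v : {w : InfinitePlace L // IsComplex w} => Wm' v (ρ v)))) := by
  classical
  haveI hH1 : ∀ (v : {w : InfinitePlace L // IsComplex w}) (τ : Perm (Fin 3)), (νH v τ).IsHaarMeasure := fun v τ => (hνH v τ).1
  haveI hH2 : ∀ (v : {w : InfinitePlace L // IsComplex w}) (τ : Perm (Fin 3)), (νH v τ).IsInvInvariant := fun v τ => (hνH v τ).2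
  haveI hT1 : ∀ (v : {w : InfinitePlace L // IsComplex w}) (τ : Perm (Fin 3)), (ντ v τ).IsHaarMeasure := fun v τ => (hντi v τ).1
  haveI hT2 : ∀ (v : {w : InfinitePlace L // IsComplex w}) (τ : Perm (Fin 3)), (ντ v τ).IsMulRightInvariant := fun v τ => (hντi v τ).2
  haveI hLC : ∀ (v : {w : InfinitePlace L // IsComplex w}) (τ : Perm (Fin 3)), LocallyCompactSpace (archLocal L 3 (Matrix.diagonal (α ∘ ⇑τ)) v) :=
    fun v τ => locallyCompactSpace_archLocal L 3 (Matrix.diagonal (α ∘ ⇑τ)) v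
  haveI hSC : ∀ (v : {w : InfinitePlace L // IsComplex w}) (τ : Perm (Fin 3)), SecondCountableTopology (archLocal L 3 (Matrix.diagonal (α ∘ ⇑τ)) v) :=
    fun v τ => secondCountableTopology_archLocal L 3 (Matrix.diagonal (α ∘ ⇑τ)) v
  haveI hLCv : ∀ v : {w : InfinitePlace L // IsComplex w}, LocallyCompactSpace (archLocal L 3 (Matrix.diagonal α) v) := fun v => locallyCompactSpace_archLocal L 3 (Matrix.diagonal α) v
  haveI hSCv : ∀ v : {w : InfinitePlace L // IsComplex w}, SecondCountableTopology (archLocal L 3 (Matrix.diagonal α) v) := fun v => secondCountableTopology_archLocal L 3 (Matrix.diagonal α) v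
  haveI hLCv' : ∀ v : {w : InfinitePlace L // IsComplex w}, LocallyCompactSpace (archLocal L 3 (Matrix.diagonal β) v) := fun v => locallyCompactSpace_archLocal L 3 (Matrix.diagonal β) v
  haveI hSCv' : ∀ v : {w : InfinitePlace L // IsComplex w}, SecondCountableTopology (archLocal L 3 (Matrix.diagonal β) v) := fun v => secondCountableTopology_archLocal L 3 (Matrix.diagonal β) v
  -- the side-`α` package (★ p841698)
  obtain ⟨c, hc, hWm, hstep⟩ := exists_wallCoef_hstep L α hα hherm z0 hwall νw hνw z₁ h02 h01 νH hνH ντ hντi hντ Θ hΘ hΘc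
  refine ⟨c, hc, ?_⟩
  -- the place induction (★ p841576)
  have key := PlaceInduction.sum_prod_mul_eq_of_step_of_regular_eq
    (fun (v : {w : InfinitePlace L // IsComplex w}) (μ : Measure (archLocal L 3 (Matrix.diagonal α) v)) => IsFiniteMeasureOnCompacts μ ∧ SigmaFinite μ)
    (fun (v : {w : InfinitePlace L // IsComplex w}) (μ : Measure (archLocal L 3 (Matrix.diagonal β) v)) => IsFiniteMeasureOnCompacts μ ∧ SigmaFinite μ)
    (fun μ : ∀ v : {w : InfinitePlace L // IsComplex w}, Measure (archLocal L 3 (Matrix.diagonal α) v) => ((∏ v : {w : InfinitePlace L // IsComplex w},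
            (Finset.univ.filter fun i => 0 < (v.1.embedding (α i)).re).card.factorial *
              (3 - (Finset.univ.filter fun i => 0 < (v.1.embedding (α i)).re).card).factorial : ℕ) : ℂ)⁻¹ *
          ∫ o, Θ ((((archPiEquivCM 3 L (Matrix.diagonal α)).symm o : arch (↥(maximalRealSubfield L)) L (IsCMField.complexConj L) 3 (Matrix.diagonal α)) :
              GL (Fin 3) (mixedSpace L)) : Matrix (Fin 3) (Fin 3) (mixedSpace L)) ∂(Measure.pi μ))
    (fun μ : ∀ v : {w : InfinitePlace L // IsComplex w}, Measure (archLocal L 3 (Matrix.diagonal β) v) => ((∏ v : {w : InfinitePlace L // IsComplex w},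
            (Finset.univ.filter fun i => 0 < (v.1.embedding (β i)).re).card.factorial *
              (3 - (Finset.univ.filter fun i => 0 < (v.1.embedding (β i)).re).card).factorial : ℕ) : ℂ)⁻¹ *
          ∫ o, Θ' ((((archPiEquivCM 3 L (Matrix.diagonal β)).symm o : arch (↥(maximalRealSubfield L)) L (IsCMField.complexConj L) 3 (Matrix.diagonal β)) :
              GL (Fin 3) (mixedSpace L)) : Matrix (Fin 3) (Fin 3) (mixedSpace L)) ∂(Measure.pi μ))
    (fun (v : {w : InfinitePlace L // IsComplex w}) (u : Fin 3 → Circle) => (νw v).map fun y : archLocal L 3 (Matrix.diagonal α) v =>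
      y * (⟨circleDiagonal 3 u, circleDiagonal_mem_archLocal_diagonal L 3 α v u⟩ : archLocal L 3 (Matrix.diagonal α) v) * y⁻¹)
    (fun (v : {w : InfinitePlace L // IsComplex w}) (u : Fin 3 → Circle) => (νw' v).map fun y : archLocal L 3 (Matrix.diagonal β) v =>
      y * (⟨circleDiagonal 3 u, circleDiagonal_mem_archLocal_diagonal L 3 β v u⟩ : archLocal L 3 (Matrix.diagonal β) v) * y⁻¹)
    (fun (v : {w : InfinitePlace L // IsComplex w}) (ρ : Perm (Fin 3)) =>
      (if 0 < (v.1.embedding (α (ρ⁻¹ 0))).re * (v.1.embedding (α (ρ⁻¹ 2))).re then (νw v).map fun y : archLocal L 3 (Matrix.diagonal α) v => y * (⟨circleDiagonal 3 (z0 v ∘ ⇑ρ), circleDiagonal_mem_archLocal_diagonal L 3 α v (z0 v ∘ ⇑ρ)⟩ : archLocal L 3 (Matrix.diagonal α) v) * y⁻¹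
              else ((quotientMeasure _ (νH v ρ⁻¹) (isClosed_coe_centralizer_singleton _) (ντ v ρ⁻¹)).map
                (descConj (⟨circleDiagonal 3 (z0 v), circleDiagonal_mem_archLocal_diagonal L 3 (α ∘ ⇑ρ⁻¹) v (z0 v)⟩ : archLocal L 3 (Matrix.diagonal (α ∘ ⇑ρ⁻¹)) v)
                  (Subgroup.centralizer ({(⟨circleDiagonal 3 (z₁ v), circleDiagonal_mem_archLocal_diagonal L 3 (α ∘ ⇑ρ⁻¹) v (z₁ v)⟩ :
                    archLocal L 3 (Matrix.diagonal (α ∘ ⇑ρ⁻¹)) v)} : Set (archLocal L 3 (Matrix.diagonal (α ∘ ⇑ρ⁻¹)) v)))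
                  (forall_mem_centralizer_circleDiagonal_comm_of_wall L (α ∘ ⇑ρ⁻¹) v (h02 v) (h01 v) (hwall v).1 (hwall v).2) id)).map
                (ContinuousMulEquiv.restrictSubgroup (GLn.conjEquiv (Matrix.GeneralLinearGroup.mkOfDetNeZero _ (det_monomial_one_ne_zero 3 ρ⁻¹)))
              (archLocal L 3 (Matrix.diagonal (α ∘ ⇑ρ⁻¹)) v) (archLocal L 3 (Matrix.diagonal α) v)
              (mem_archLocal_comp_perm_iff_conj_mem L 3 α v ρ⁻¹))))
    Wm'
    (fun (v : {w : InfinitePlace L // IsComplex w}) (ρ : Perm (Fin 3)) => (if 0 < (v.1.embedding (α (ρ⁻¹ 0))).re * (v.1.embedding (α (ρ⁻¹ 2))).re then (2 : ℂ) else c v ρ⁻¹))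
    κ' z0 hwall
    (fun v u hu => by
      haveI : IsFiniteMeasureOnCompacts (νw v) := (hνw v).1.toIsFiniteMeasureOnCompacts
      exact isFiniteMeasureOnCompacts_and_sigmaFinite_map_conj_of_injective L α hα v (νw v) u hu)
    (fun v u hu => by
      haveI : IsFiniteMeasureOnCompacts (νw' v) := (hνw' v).1.toIsFiniteMeasureOnCompacts
      exact isFiniteMeasureOnCompacts_and_sigmaFinite_map_conj_of_injective L β hβ v (νw' v) u hu)
    hWm hWm' hstep hstep' hreg
  simpa only using key

end Literature.NumberTheory.Rogawski1990

end
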